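import Mathlib.Analysis.Matrix.Spectrum
import Mathlib.Analysis.Matrix.PosDef
import Mathlib.LinearAlgebra.Matrix.GeneralLinearGroup.Defs
import Literature.RepresentationTheory.CompactGroups.ExponentialPolynomials
import Literature.NumberTheory.Automorphic.ZariskiGL
import HarnessLib

/-!
# The unitary points of a self-adjoint complex algebraic group are Zariski dense

Topic `RepresentationTheory/CompactGroups`. Let `M ≤ GL n ℂ` be an algebraic subgroup (zero locus
of polynomials in the matrix entries and `det⁻¹`, the tree's `IsAlgebraicSubgroup`) which is
*self-adjoint*: `g ∈ M ⇒ g⋆ ∈ M`. Then every polynomial vanishing on the unitary elements of `M`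
vanishes on all of `M` (`eval_eq_zero_of_forall_mem_unitaryGroup`); equivalently `M` is the
Zariski closure of `M ∩ U(n)` (`le_of_isAlgebraicSubgroup_of_unitary_mem`,
`subset_zeroLocusGL_of_unitary_mem`). This is the algebraic content of the polar decomposition
`M = (M ∩ U(n)) · exp(𝔭)` of a self-adjoint algebraic group (Onishchik–Vinberg, *Lie Groups and
Algebraic Groups* (1990), Ch. 5 §2; Knapp, *Lie Groups Beyond an Introduction*, Prop. 1.143) and is
the step "the complexification of a compact group `K` is the Zariski closure of `K`" in Chevalley's
theory of compact Lie groups; it is used for `ExistsAbelianCentralizer`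
(`MaximalTorusCentralizer`).

Proof (no complex analysis). For `g ∈ M`, `A = g⋆ g ∈ M` is positive definite, `A = U diag(λ) U⋆`
(Mathlib's spectral theorem), and the curve `P(z) = U diag(e^{z log λ}) U⋆` of complex powers of
`A` satisfies `P(k) = Aᵏ ∈ M` for `k ∈ ℕ`. Along `P` every polynomial in the coordinates is an
exponential polynomial with real frequencies (`ExponentialPolynomials`), so the defining
polynomials of `M`, vanishing on `ℕ`, vanish identically: `P(z) ∈ M` for all `z ∈ ℂ`. Then
`u = g P(-1/2) ∈ M` is unitary and `u P(iσ) ∈ M ∩ U(n)` for real `σ`, so a polynomial vanishing on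
`M ∩ U(n)` gives an exponential polynomial vanishing on the imaginary axis, hence at `z = 1/2`,
where `u P(1/2) = g`.

The family `P(z)` is written out in every statement (local notation `𝐏[U, λ, z]`); there are no
definitions. Mathlib: `Matrix.IsHermitian.spectral_theorem`, `Matrix.PosDef.eigenvalues_pos`,
`Matrix.GeneralLinearGroup.mkOfDetNeZero`; nothing on polar decompositions of matrix groups
(`lean search 'polar.*algebraic|selfAdjoint.*Zariski|unitary.*Zariski dense'`).

## References

* A. L. Onishchik, E. B. Vinberg, *Lie Groups and Algebraic Groups*, Springer (1990), Ch. 5 §2.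
* A. W. Knapp, *Lie Groups Beyond an Introduction*, 2nd ed. (2002), Prop. 1.143.
* C. Chevalley, *Theory of Lie Groups I*, Princeton (1946), Ch. VI §IX.
-/

noncomputable section

/-! ## Unitary points of a self-adjoint algebraic group are Zariski dense -/

namespace Literature.RepresentationTheory.CompactGroups

open Literature.NumberTheory.Automorphic Matrix Complex
open scoped ComplexOrder

variable {n : Type*} [Fintype n] [DecidableEq n]

/-! ### The one-parameter family `P(z) = U · diag(e^{z log λ}) · U⋆` of complex powers of a
positive definite matrix -/

section Family

variable (U : Matrix.unitaryGroup n ℂ) (lam : n → ℝ)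

/-- Local notation for the family `P(z) = U · diag(e^{z log λ_i}) · U⋆`. -/
local notation3 (prettyPrint := false) "𝐏[" UU ", " ll ", " zz "]" => (UU : Matrix n n ℂ) *
  Matrix.diagonal (fun i : n => Complex.exp (zz * ((Real.log (ll i) : ℝ) : ℂ))) *
    star (UU : Matrix n n ℂ)

/-- `U U⋆ = 1` for a unitary matrix, with the star taken in `Matrix n n ℂ`. [folklore] -/
theorem coe_mul_star_coe_unitaryGroup : (U : Matrix n n ℂ) * star (U : Matrix n n ℂ) = 1 :=
  Unitary.coe_mul_star_self U

/-- `U⋆ U = 1` for a unitary matrix, with the star taken in `Matrix n n ℂ`. [folklore] -/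
theorem star_coe_mul_coe_unitaryGroup : star (U : Matrix n n ℂ) * (U : Matrix n n ℂ) = 1 :=
  Unitary.coe_star_mul_self U

/-- Group law: `P(z + w) = P(z) P(w)`. [folklore] -/
theorem powFamily_add (z w : ℂ) : 𝐏[U, lam, z + w] = 𝐏[U, lam, z] * 𝐏[U, lam, w] := by
  have hU : star (U : Matrix n n ℂ) * (U : Matrix n n ℂ) = 1 := Unitary.coe_star_mul_self U
  have hd : (fun i : n => exp ((z + w) * ((Real.log (lam i) : ℝ) : ℂ))) =
      fun i : n => exp (z * ((Real.log (lam i) : ℝ) : ℂ)) * exp (w * ((Real.log (lam i) : ℝ) : ℂ)) := by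
    funext i
    rw [← exp_add]
    ring_nf
  symm
  calc 𝐏[U, lam, z] * 𝐏[U, lam, w]
      = (U : Matrix n n ℂ) * Matrix.diagonal (fun i : n => exp (z * ((Real.log (lam i) : ℝ) : ℂ)))
          * (star (U : Matrix n n ℂ) * (U : Matrix n n ℂ))
          * Matrix.diagonal (fun i : n => exp (w * ((Real.log (lam i) : ℝ) : ℂ)))
          * star (U : Matrix n n ℂ) := by simp only [Matrix.mul_assoc]
    _ = 𝐏[U, lam, z + w] := by
        rw [hU, Matrix.mul_one, Matrix.mul_assoc (U : Matrix n n ℂ), Matrix.diagonal_mul_diagonal,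
          ← hd]

/-- `P(0) = 1`. [folklore] -/
theorem powFamily_zero : 𝐏[U, lam, (0 : ℂ)] = 1 := by
  have hd : (fun i : n => exp ((0 : ℂ) * ((Real.log (lam i) : ℝ) : ℂ))) = fun _ => 1 := by
    funext i
    rw [zero_mul, exp_zero]
  rw [hd, Matrix.diagonal_one, Matrix.mul_one, coe_mul_star_coe_unitaryGroup]

/-- `P(z)⋆ = P(conj z)` (the frequencies `log λ_i` are real). [folklore] -/
theorem star_powFamily (z : ℂ) : star 𝐏[U, lam, z] = 𝐏[U, lam, starRingEnd ℂ z] := by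
  have hd : star (fun i : n => exp (z * ((Real.log (lam i) : ℝ) : ℂ))) =
      fun i : n => exp (starRingEnd ℂ z * ((Real.log (lam i) : ℝ) : ℂ)) := by
    funext i
    simp only [Pi.star_apply, RCLike.star_def, ← exp_conj, map_mul, conj_ofReal]
  rw [star_mul, star_mul, Matrix.star_eq_conjTranspose (Matrix.diagonal _),
    Matrix.diagonal_conjTranspose, star_star, Matrix.mul_assoc, hd]

/-- `P(conj z) P(z)`-type identity: `P(z)⋆ P(z) = P(conj z + z)`. [folklore] -/
theorem star_powFamily_mul_self (z : ℂ) :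
    star 𝐏[U, lam, z] * 𝐏[U, lam, z] = 𝐏[U, lam, starRingEnd ℂ z + z] := by
  rw [star_powFamily, ← powFamily_add]

/-- `det P(z) = e^{z Σ log λ_i}`; in particular it is non-zero. [folklore] -/
theorem det_powFamily (z : ℂ) :
    Matrix.det 𝐏[U, lam, z] = exp (z * ∑ i, ((Real.log (lam i) : ℝ) : ℂ)) := by
  have h1 : Matrix.det (U : Matrix n n ℂ) * Matrix.det (star (U : Matrix n n ℂ)) = 1 := by
    rw [← Matrix.det_mul, coe_mul_star_coe_unitaryGroup, Matrix.det_one]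
  rw [Matrix.det_mul, Matrix.det_mul]
  calc Matrix.det (U : Matrix n n ℂ) *
        Matrix.det (Matrix.diagonal (fun i : n => exp (z * ((Real.log (lam i) : ℝ) : ℂ)))) *
        Matrix.det (star (U : Matrix n n ℂ))
      = Matrix.det (Matrix.diagonal (fun i : n => exp (z * ((Real.log (lam i) : ℝ) : ℂ)))) *
          (Matrix.det (U : Matrix n n ℂ) * Matrix.det (star (U : Matrix n n ℂ))) := by ring
    _ = exp (z * ∑ i, ((Real.log (lam i) : ℝ) : ℂ)) := by
        rw [h1, mul_one, Matrix.det_diagonal, Finset.mul_sum, exp_sum]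

variable {lam} in
/-- If `A = U · diag(λ) · U⋆` with all `λ_i > 0` then `P(1) = A`. [folklore] -/
theorem powFamily_one {A : Matrix n n ℂ} (hlam : ∀ i, 0 < lam i)
    (hA : A = (U : Matrix n n ℂ) * Matrix.diagonal (fun i => ((lam i : ℝ) : ℂ)) *
      star (U : Matrix n n ℂ)) :
    𝐏[U, lam, (1 : ℂ)] = A := by
  have hd : (fun i : n => exp (1 * ((Real.log (lam i) : ℝ) : ℂ))) = fun i => ((lam i : ℝ) : ℂ) := by
    funext i
    rw [one_mul, ← Complex.ofReal_exp, Real.exp_log (hlam i)]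
  rw [hA, hd]

variable {lam} in
/-- `P(k) = A^k` for `k ∈ ℕ`. [folklore] -/
theorem powFamily_natCast {A : Matrix n n ℂ} (hlam : ∀ i, 0 < lam i)
    (hA : A = (U : Matrix n n ℂ) * Matrix.diagonal (fun i => ((lam i : ℝ) : ℂ)) *
      star (U : Matrix n n ℂ)) (k : ℕ) :
    𝐏[U, lam, (k : ℂ)] = A ^ k := by
  induction k with
  | zero => rw [Nat.cast_zero, pow_zero]; exact powFamily_zero U lam
  | succ k ih =>
    rw [Nat.cast_succ, powFamily_add, ih, powFamily_one U hlam hA, pow_succ]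

/-- **The coordinates of `g₀ · P(z)` are exponential polynomials in `z` with real frequencies.**
For a fixed invertible `g₀` there are elements `a_c ∈ ℂ[ℝ]` (`c` a coordinate of `GL n`: an entry
or `det⁻¹`) with `a_c(z) = c(g₀ P(z))` for all `z`: the entries are
`Σ_i (g₀U)_{ai} (U⋆)_{ib} e^{z log λ_i}` and `det⁻¹ = det(g₀)⁻¹ e^{-z Σ log λ_i}`. [folklore] -/
theorem exists_expPoly_coords (g₀ : GL n ℂ) (h : ∀ z : ℂ, Matrix.det 𝐏[U, lam, z] ≠ 0) :
    ∃ a : GLCoord n → AddMonoidAlgebra ℂ ℝ, ∀ (z : ℂ) (c : GLCoord n),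
      expPolyEval (a c) z =
        glCoordFun (g₀ * Matrix.GeneralLinearGroup.mkOfDetNeZero 𝐏[U, lam, z] (h z)) c := by
  classical
  refine ⟨fun c => match c with
    | Sum.inl ab => ∑ i : n, AddMonoidAlgebra.single (Real.log (lam i))
        ((((g₀ : GL n ℂ) : Matrix n n ℂ) * (U : Matrix n n ℂ)) ab.1 i *
          (star (U : Matrix n n ℂ)) i ab.2)
    | Sum.inr _ => AddMonoidAlgebra.single (-∑ i : n, Real.log (lam i))
        ((Matrix.det ((g₀ : GL n ℂ) : Matrix n n ℂ))⁻¹), fun z c => ?_⟩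
  rcases c with ⟨a, b⟩ | u
  · simp only [map_sum, Finset.sum_apply, expPolyEval_single, glCoordFun_inl, Units.val_mul,
      Matrix.GeneralLinearGroup.val_mkOfDetNeZero]
    rw [← Matrix.mul_assoc, ← Matrix.mul_assoc, Matrix.mul_apply]
    refine Finset.sum_congr rfl fun i _ => ?_
    rw [Matrix.mul_diagonal]
    ring
  · rw [glCoordFun_inr, Units.val_mul, Matrix.GeneralLinearGroup.val_mkOfDetNeZero,
      Matrix.det_mul, det_powFamily, expPolyEval_single, mul_inv, ← exp_neg]
    push_cast
    ring_nf

end Family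

/-! ### Evaluating a polynomial on an exponential-polynomial curve -/

/-- If every coordinate of a curve `z ↦ γ(z) ∈ GL n` is the exponential polynomial `a_c`, then a
polynomial `f` in the coordinates evaluates along `γ` to the exponential polynomial `f(a)`.
[folklore] -/
theorem eval_glCoordFun_eq_expPolyEval {γ : ℂ → GL n ℂ} {a : GLCoord n → AddMonoidAlgebra ℂ ℝ}
    (ha : ∀ (z : ℂ) (c : GLCoord n), expPolyEval (a c) z = glCoordFun (γ z) c)
    (f : MvPolynomial (GLCoord n) ℂ) (z : ℂ) :
    MvPolynomial.eval (glCoordFun (γ z)) f = expPolyEval (MvPolynomial.aeval a f) z := by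
  have h1 : expPolyEval (MvPolynomial.aeval a f) z =
      ((Pi.evalAlgHom ℂ (fun _ : ℂ => ℂ) z).comp (expPolyEval.comp (MvPolynomial.aeval a))) f :=
    rfl
  have h2 : (fun c => expPolyEval (a c) z) = glCoordFun (γ z) := funext (ha z)
  calc MvPolynomial.eval (glCoordFun (γ z)) f = MvPolynomial.aeval (glCoordFun (γ z)) f := rfl
    _ = MvPolynomial.aeval (fun c => expPolyEval (a c) z) f := by rw [h2]
    _ = expPolyEval (MvPolynomial.aeval a f) z := by
        rw [h1, MvPolynomial.comp_aeval, MvPolynomial.comp_aeval]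
        rfl

/-! ### The density theorem -/

/-- **The unitary points of a self-adjoint algebraic group are Zariski dense** (the algebraic
content of the polar decomposition `M = (M ∩ U(n)) · exp 𝔭` of a self-adjoint algebraic group;
Onishchik–Vinberg, *Lie Groups and Algebraic Groups*, Ch. 5 §2). Let `M ≤ GL n ℂ` be an algebraic
subgroup stable under `g ↦ g⋆`. If a polynomial `f` in the matrix entries and `det⁻¹` vanishes at
every unitary element of `M`, it vanishes on `M`.

Proof. For `g ∈ M` the positive definite `A = g⋆ g ∈ M` is `U diag(λ) U⋆`; the curve
`P(z) = U diag(e^{z log λ}) U⋆` has `P(k) = Aᵏ ∈ M`, and every defining polynomial of `M` is an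
exponential polynomial with real frequencies along `P`, vanishing on `ℕ`, hence identically: so
`P(z) ∈ M` for all complex `z`. Then `u = g P(-1/2) ∈ M` is unitary, `u P(iσ) ∈ M` is unitary for
real `σ`, so `z ↦ f(u P(z))`, an exponential polynomial with real frequencies, vanishes on the
imaginary axis, hence at `z = 1/2`, where `u P(1/2) = g`. [folklore] -/
theorem eval_eq_zero_of_forall_mem_unitaryGroup {M : Subgroup (GL n ℂ)} (hM : IsAlgebraicSubgroup M)
    (hstar : ∀ g ∈ M, star g ∈ M) {f : MvPolynomial (GLCoord n) ℂ}
    (hf : ∀ g ∈ M, (g : Matrix n n ℂ) ∈ Matrix.unitaryGroup n ℂ →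
      MvPolynomial.eval (glCoordFun g) f = 0)
    {g : GL n ℂ} (hg : g ∈ M) : MvPolynomial.eval (glCoordFun g) f = 0 := by
  classical
  -- the positive definite matrix `A = g⋆ g` and its spectral decomposition
  set A : Matrix n n ℂ := star (g : Matrix n n ℂ) * (g : Matrix n n ℂ) with hAdef
  have hApos : A.PosDef := by
    rw [hAdef, Matrix.star_eq_conjTranspose]
    exact Matrix.PosDef.conjTranspose_mul_self _ (Matrix.mulVec_injective_of_isUnit g.isUnit)
  have hAh : A.IsHermitian := hApos.1
  set U : Matrix.unitaryGroup n ℂ := hAh.eigenvectorUnitary with hUdef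
  set lam : n → ℝ := hAh.eigenvalues with hlamdef
  have hlam : ∀ i, 0 < lam i := hApos.eigenvalues_pos
  have hAspec : A = (U : Matrix n n ℂ) * Matrix.diagonal (fun i => ((lam i : ℝ) : ℂ)) *
      star (U : Matrix n n ℂ) := by
    have h := hAh.spectral_theorem
    rw [Unitary.conjStarAlgAut_apply] at h
    exact h
  -- the curve `P(z)` in `GL n ℂ`
  have hdet : ∀ z : ℂ, Matrix.det ((U : Matrix n n ℂ) *
      Matrix.diagonal (fun i : n => exp (z * ((Real.log (lam i) : ℝ) : ℂ))) *
        star (U : Matrix n n ℂ)) ≠ 0 := fun z => by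
    rw [det_powFamily]; exact exp_ne_zero _
  obtain ⟨P, hPval⟩ : ∃ P : ℂ → GL n ℂ, ∀ z, ((P z : GL n ℂ) : Matrix n n ℂ) = (U : Matrix n n ℂ) *
      Matrix.diagonal (fun i : n => exp (z * ((Real.log (lam i) : ℝ) : ℂ))) *
        star (U : Matrix n n ℂ) :=
    ⟨fun z => Matrix.GeneralLinearGroup.mkOfDetNeZero _ (hdet z), fun z => rfl⟩
  have hPmk : ∀ z, Matrix.GeneralLinearGroup.mkOfDetNeZero _ (hdet z) = P z := fun z =>
    Units.ext (by rw [Matrix.GeneralLinearGroup.val_mkOfDetNeZero, hPval])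
  have hPadd : ∀ z w, P (z + w) = P z * P w := fun z w =>
    Units.ext (by rw [Units.val_mul, hPval, hPval, hPval, powFamily_add])
  have hPzero : P 0 = 1 := Units.ext (by rw [hPval, Units.val_one, powFamily_zero])
  have hPstar : ∀ z, star (P z) * P z = P (starRingEnd ℂ z + z) := fun z =>
    Units.ext (by rw [Units.val_mul, Units.coe_star, hPval, hPval, star_powFamily_mul_self])
  -- `A = g⋆ g` as an element of `M`, and `P(k) = Aᵏ`
  have hAM : star g * g ∈ M := M.mul_mem (hstar g hg) hg
  have hPnat : ∀ k : ℕ, P k = (star g * g) ^ k := fun k =>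
    Units.ext (by rw [hPval, Units.val_pow_eq_pow_val, Units.val_mul, Units.coe_star,
      powFamily_natCast U hlam hAspec])
  -- Step 1: `P(z) ∈ M` for every complex `z`
  obtain ⟨S, hS⟩ := hM
  have hmemS : ∀ x : GL n ℂ, x ∈ M ↔ ∀ p ∈ S, MvPolynomial.eval (glCoordFun x) p = 0 := by
    intro x
    change x ∈ (M : Set (GL n ℂ)) ↔ _
    rw [hS]
    rfl
  obtain ⟨a₁, ha₁⟩ := exists_expPoly_coords U lam 1 hdet
  have ha₁' : ∀ (z : ℂ) (c : GLCoord n), expPolyEval (a₁ c) z = glCoordFun (P z) c := by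
    intro z c; rw [ha₁ z c, one_mul, hPmk]
  have hPmem : ∀ z : ℂ, P z ∈ M := by
    intro z
    rw [hmemS]
    intro p hp
    have hvan : MvPolynomial.aeval a₁ p = 0 := by
      refine eq_zero_of_forall_expPolyEval_natCast_eq_zero _ fun k => ?_
      rw [← eval_glCoordFun_eq_expPolyEval ha₁' p k]
      have hk : P k ∈ M := by rw [hPnat]; exact M.pow_mem hAM k
      exact (hmemS _).1 hk p hp
    rw [eval_glCoordFun_eq_expPolyEval ha₁' p z, hvan, map_zero, Pi.zero_apply]
  -- Step 2: the unitary element `u = g P(-1/2)` and the unitary curve `u P(iσ)`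
  obtain ⟨u, hudef⟩ : ∃ u : GL n ℂ, u = g * P (-(1 / 2 : ℂ)) := ⟨_, rfl⟩
  have huM : u ∈ M := hudef ▸ M.mul_mem hg (hPmem _)
  have hhalf : (starRingEnd ℂ) (-(1 / 2 : ℂ)) = -(1 / 2 : ℂ) := by
    rw [map_neg, map_div₀, map_one, map_ofNat]
  have hP1 : P 1 = star g * g := by rw [← Nat.cast_one, hPnat 1, pow_one]
  have hcomm : P 1 * P (-(1 / 2 : ℂ)) = P (-(1 / 2 : ℂ)) * P 1 := by
    rw [← hPadd, ← hPadd, add_comm]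
  have hneg : (-(1 / 2 : ℂ)) + -(1 / 2 : ℂ) + 1 = 0 := by norm_num
  have hustar : star u * u = 1 := by
    calc star u * u = star (P (-(1 / 2 : ℂ))) * (P 1 * P (-(1 / 2 : ℂ))) := by
          rw [hudef, star_mul, hP1]; simp only [mul_assoc]
      _ = star (P (-(1 / 2 : ℂ))) * P (-(1 / 2 : ℂ)) * P 1 := by rw [hcomm, mul_assoc]
      _ = 1 := by rw [hPstar, hhalf, ← hPadd, hneg, hPzero]
  have hunit : ∀ σ : ℝ, ((u * P (I * σ) : GL n ℂ) : Matrix n n ℂ) ∈ Matrix.unitaryGroup n ℂ := by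
    intro σ
    rw [Matrix.mem_unitaryGroup_iff']
    have h1 : star (u * P (I * σ)) * (u * P (I * σ)) = 1 := by
      rw [star_mul, mul_assoc, ← mul_assoc (star u), hustar, one_mul, hPstar]
      have : (starRingEnd ℂ) (I * σ) + I * σ = 0 := by simp [conj_ofReal]
      rw [this, hPzero]
    have h2 := congrArg (fun x : GL n ℂ => (x : Matrix n n ℂ)) h1
    simpa only [Units.val_mul, Units.coe_star, Units.val_one] using h2
  -- `z ↦ f(u P(z))` vanishes on the imaginary axis, hence everywhere
  obtain ⟨a₂, ha₂0⟩ := exists_expPoly_coords U lam u hdet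
  have ha₂ : ∀ (z : ℂ) (c : GLCoord n), expPolyEval (a₂ c) z = glCoordFun (u * P z) c := by
    intro z c; rw [ha₂0 z c, hPmk]
  have hvan₂ : MvPolynomial.aeval a₂ f = 0 := by
    refine eq_zero_of_forall_expPolyEval_I_mul_eq_zero _ fun σ => ?_
    rw [← eval_glCoordFun_eq_expPolyEval (γ := fun z => u * P z) ha₂ f (I * σ)]
    exact hf _ (M.mul_mem huM (hPmem _)) (hunit σ)
  have hpos : (-(1 / 2 : ℂ)) + (1 / 2 : ℂ) = 0 := by norm_num
  have hgu : g = u * P (1 / 2 : ℂ) := by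
    rw [hudef, mul_assoc, ← hPadd, hpos, hPzero, mul_one]
  rw [hgu, eval_glCoordFun_eq_expPolyEval (γ := fun z => u * P z) ha₂ f (1 / 2 : ℂ), hvan₂,
    map_zero, Pi.zero_apply]

/-- **Zariski-closure form**: for a self-adjoint algebraic `M ≤ GL n ℂ`, any algebraic subgroup
(indeed any Zariski-closed set) containing the unitary elements of `M` contains `M`. [folklore] -/
theorem le_of_isAlgebraicSubgroup_of_unitary_mem {M K : Subgroup (GL n ℂ)}
    (hM : IsAlgebraicSubgroup M) (hstar : ∀ g ∈ M, star g ∈ M) (hK : IsAlgebraicSubgroup K)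
    (hUK : ∀ g ∈ M, (g : Matrix n n ℂ) ∈ Matrix.unitaryGroup n ℂ → g ∈ K) : M ≤ K := by
  obtain ⟨S, hS⟩ := hK
  intro g hg
  change g ∈ (K : Set (GL n ℂ))
  rw [hS]
  intro p hp
  refine eval_eq_zero_of_forall_mem_unitaryGroup hM hstar (fun x hx hxU => ?_) hg
  have hxK : x ∈ (K : Set (GL n ℂ)) := hUK x hx hxU
  rw [hS] at hxK
  exact hxK p hp

/-- The same for a Zariski-closed **subset**: a zero locus containing the unitary elements of a
self-adjoint algebraic `M` contains `M`. [folklore] -/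
theorem subset_zeroLocusGL_of_unitary_mem {M : Subgroup (GL n ℂ)} (hM : IsAlgebraicSubgroup M)
    (hstar : ∀ g ∈ M, star g ∈ M) (S : Set (MvPolynomial (GLCoord n) ℂ))
    (hU : ∀ g ∈ M, (g : Matrix n n ℂ) ∈ Matrix.unitaryGroup n ℂ → g ∈ zeroLocusGL S) :
    (M : Set (GL n ℂ)) ⊆ zeroLocusGL S := fun _ hg p hp =>
  eval_eq_zero_of_forall_mem_unitaryGroup hM hstar (fun x hx hxU => hU x hx hxU p hp) hg

end Literature.RepresentationTheory.CompactGroups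

end
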